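import Summits.QuantumFields.GaugeBoot.RPBootstrapCertificatesZd
import Summits.QuantumFields.GaugeBoot.HaarShiftDLR
import HarnessLib

/-!
# Class-B states are feasible for Kazakov–Zheng's complete infinite-lattice SDP at every level (gauge-boot, L3(α) ↔ L1/L4 junction)

HONEST FRAMING (cell `pub-gaugeboot`, page 1 of every file): the venture produces certified bounds
on lattice expectations at stated coupling, gauge group, dimension and torus size; NOT a mass gap,
NOT a continuum limit, NOT a string tension; NOT Yang–Mills-summit-bearing (barriers
`FixedCouplingUltralocality`, `PerturbativeInvisibility`). Structural; it certifies no number.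

## Content (`SU(N)` on `ℤ^d`, word level `n`)

`ClassB.lean` (task L3(α)) axiomatised the states a Kazakov–Zheng infinite-lattice certificate
quantifies over: probability measures on `LGConfig d G` invariant under `ℤ^d ⋊ B_d`, one-link Gibbs
(`IsHaarShiftState`, = DLR by `HaarShiftDLR`), and reflection positive for the THREE mirror families
(sites `x_i = 0`, links `x_i = ½`, diagonals `x_i = x_j`). `BootstrapRPCutsZd` defined the bootstrap
side with the site and link cuts. Here the third family is added and the junction is made:

* `IsDiagRPCutFunctional r n φ` — the diagonal cuts `0 ≤ φ ((F ∘ Θ^diag_{ij}) F)`, `F` in the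
  degree-`n` word space at `diagHalfEdges i j`, `i ≠ j`; `isDiagRPCutFunctional_expectation`
  (sound for diagonal-RP measures);
* ★ `kzLevelValuesZdSuN N β n P` — THE COMPLETE KZ SDP AT LEVEL `n`: loop equations, positivity,
  the full lattice symmetry, and the RP cuts of all three families; `⊆ rpFullSym ⊆ fullSym ⊆ … ⊆
  plain`; antitone;
* ★★★ `ClassBState.integral_mem_kzLevelValuesZd` — EVERY CLASS-B STATE IS FEASIBLE FOR THE
  COMPLETE KZ SDP AT EVERY LEVEL: `∫ P dω.μ ∈ kzLevelValuesZdSuN N β n P`; hence ★★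
  `ClassBState.integral_le_of_forall_kzLevelValuesZd_le` — a bound valid for all level-`n` values of
  the complete SDP bounds `∫ P dω.μ` for every Class-B state `ω` (this is SCOPING A18's reading of a
  KZ certificate, now a theorem about the tree's objects);
* ★★ `integral_mem_kzLevelValuesZd_of_torusLimitPointsDiagonalRP` — CONDITIONAL (`β ≥ 0`): under
  the open hypothesis `TorusLimitPointsDiagonalRP` (`ClassBIdentification`: equivalent to the
  Class-B identification) every thermodynamic limit point of the torus states is feasible for the
  complete SDP; unconditionally it is feasible for the SDP without the diagonal cuts
  (`integral_mem_rpFullSymLevelValuesZd_of_mem_infiniteVolumeLimitPoints`).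

What this is NOT: inhabitation of Class B at a given `β` beyond what `ClassB*` files prove; the
diagonal RP of torus limit points (OPEN); convergence of the complete hierarchy (the site+link one
converges, `RPBootstrapConvergenceZd`; with diagonal cuts the limit states would be diagonal-RP —
same proof, not repeated); numbers.

References: V. Kazakov, Z. Zheng, arXiv:2203.11360 §3.1, arXiv:2404.16925 §3.2; K. Osterwalder,
E. Seiler, Ann. Phys. 110 (1978) 440. Folklore.
-/

noncomputable section

open MeasureTheory
open scoped ComplexOrder
open Literature.MathematicalPhysics.QuantumFieldTheory (LatticeRep)
open Literature.Probability.LatticeModels (Site)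
open Literature.MathematicalPhysics.QuantumLattice

namespace Summit.QuantumFields.GaugeBoot

/-! ## The diagonal cuts -/

section Cuts

variable {d : ℕ} {G : Type*} [Group G] [TopologicalSpace G] (r : LatticeRep G)

/-- **Diagonal reflection-positivity cuts at degree `n`**: `0 ≤ φ ((F ∘ Θ^diag_{ij}) F)` for `F`
in the degree-`n` word space at the diagonal half-space `diagHalfEdges i j`, `i ≠ j`. [folklore] -/
def IsDiagRPCutFunctional (n : ℕ) (φ : C(LGConfig d G, ℝ) →ₗ[ℝ] ℝ) : Prop :=
  ∀ (i j : Fin d), i ≠ j → ∀ F ∈ wordSpace r (diagHalfEdges i j) n,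
    0 ≤ φ (F.comp (zdDiagSwapCM (G := G) i j) * F)

/-- Fewer test functions at lower degree. -/
theorem IsDiagRPCutFunctional.mono {m n : ℕ} (hmn : m ≤ n) {φ : C(LGConfig d G, ℝ) →ₗ[ℝ] ℝ}
    (h : IsDiagRPCutFunctional r n φ) : IsDiagRPCutFunctional r m φ :=
  fun i j hij F hF => h i j hij F (wordSpace_mono r subset_rfl hmn hF)

variable [CompactSpace G] [MeasurableSpace G] [BorelSpace G] [SecondCountableTopology G]

/-- **Soundness of the diagonal cuts** for a diagonal-RP measure. -/
theorem isDiagRPCutFunctional_expectation {μ : Measure (LGConfig d G)} [IsFiniteMeasure μ]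
    (h : ∀ i j : Fin d, i ≠ j → IsReflectionPositiveFor (configDiagSwapZd (G := G) i j) (diagHalfEdges i j) μ)
    (n : ℕ) : IsDiagRPCutFunctional r n (expectationFunctional μ) := fun i j hij F hF => by
  rw [expectationFunctional_apply]
  exact integral_comp_mul_nonneg_of_isReflectionPositiveFor r (h i j hij) _ (zdDiagSwapCM_apply i j) hF

end Cuts

/-! ## `SU(N)`: the complete SDP and Class B -/

section ZdSuN

variable {d : ℕ} (N : ℕ) (β : ℝ)

/-- ★ **Kazakov–Zheng's complete infinite-lattice SDP at level `n`**: level-`n` feasible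
functionals invariant on the words of length `≤ 2n` under translations, axis permutations and axis
reflections, with the site-, link- AND diagonal-RP cuts at degree `n`. [folklore] -/
def kzLevelValuesZdSuN (n : ℕ) (P : C(LGConfig d (Matrix.specialUnitaryGroup (Fin N) ℂ), ℝ)) : Set ℝ :=
  {t | ∃ φ : C(LGConfig d (Matrix.specialUnitaryGroup (Fin N) ℂ), ℝ) →ₗ[ℝ] ℝ,
    IsBootstrapFeasible (fundamentalLatticeRep N) (suExp N)
        (fun e => wilsonBoundaryAction (fundamentalRep (Fin N)) {e}) β
        (wordTruncation (ι := ZdEdge d) (fundamentalLatticeRep N) n) φ ∧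
      (∀ (v : Fin d → ℤ), ∀ x ∈ wordTruncation (ι := ZdEdge d) (fundamentalLatticeRep N) (n + n),
        φ (x.comp (relabelCM (G := Matrix.specialUnitaryGroup (Fin N) ℂ) (edgeShift v))) = φ x) ∧
      (∀ (σ : Equiv.Perm (Fin d)), ∀ x ∈ wordTruncation (ι := ZdEdge d) (fundamentalLatticeRep N) (n + n),
        φ (x.comp (relabelCM (G := Matrix.specialUnitaryGroup (Fin N) ℂ) (edgePerm σ))) = φ x) ∧
      (∀ (i : Fin d), ∀ x ∈ wordTruncation (ι := ZdEdge d) (fundamentalLatticeRep N) (n + n),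
        φ (x.comp (zdSiteReflectCM (G := Matrix.specialUnitaryGroup (Fin N) ℂ) i)) = φ x) ∧
      IsSiteRPCutFunctional (fundamentalLatticeRep N) n φ ∧
      IsLinkRPCutFunctional (fundamentalLatticeRep N) n φ ∧
      IsDiagRPCutFunctional (fundamentalLatticeRep N) n φ ∧ φ P = t}

/-- The diagonal cuts shrink further: `kz ⊆ rpFullSym`. -/
theorem kzLevelValuesZd_subset_rpFullSym (n : ℕ) (P : C(LGConfig d (Matrix.specialUnitaryGroup (Fin N) ℂ), ℝ)) :
    kzLevelValuesZdSuN (d := d) N β n P ⊆ rpFullSymLevelValuesZdSuN (d := d) N β n P := by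
  rintro t ⟨φ, hφ, hT, hperm, hrefl, hsite, hlink, -, rfl⟩
  exact ⟨φ, hφ, hT, hperm, hrefl, hsite, hlink, rfl⟩

/-- `kz ⊆ plain`. -/
theorem kzLevelValuesZd_subset_levelValuesZd (n : ℕ) (P : C(LGConfig d (Matrix.specialUnitaryGroup (Fin N) ℂ), ℝ)) :
    kzLevelValuesZdSuN (d := d) N β n P ⊆ levelValuesZdSuN (d := d) N β n P := by
  rintro t ⟨φ, hφ, -, -, -, -, -, -, rfl⟩
  exact ⟨φ, hφ, rfl⟩

/-- **Higher level, fewer values.** -/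
theorem kzLevelValuesZd_anti {m n : ℕ} (hmn : n ≤ m) (P : C(LGConfig d (Matrix.specialUnitaryGroup (Fin N) ℂ), ℝ)) :
    kzLevelValuesZdSuN (d := d) N β m P ⊆ kzLevelValuesZdSuN (d := d) N β n P := by
  rintro t ⟨φ, hφ, hT, hperm, hrefl, hsite, hlink, hdiag, rfl⟩
  exact ⟨φ, hφ.mono (fundamentalLatticeRep N) (wordTruncation_mono _ hmn),
    fun v x hx => hT v x (wordTruncation_mono _ (Nat.add_le_add hmn hmn) hx),
    fun σ x hx => hperm σ x (wordTruncation_mono _ (Nat.add_le_add hmn hmn) hx),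
    fun i x hx => hrefl i x (wordTruncation_mono _ (Nat.add_le_add hmn hmn) hx),
    hsite.mono _ hmn, hlink.mono _ hmn, hdiag.mono _ hmn, rfl⟩

/-- ★★ **Soundness for the reflection-positive fully symmetric Gibbs states with all three RP
families.** -/
theorem dlr_integral_mem_kzLevelValuesZd (n : ℕ)
    {μ : Measure (LGConfig d (Matrix.specialUnitaryGroup (Fin N) ℂ))}
    (hμ : μ ∈ ymGibbsMeasures (d := d) (fundamentalRep (Fin N)) β) (hT : IsZdTranslationInvariant μ)
    (hperm : ∀ σ : Equiv.Perm (Fin d), μ.map (relabelConfig (edgePerm σ)) = μ)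
    (hrefl : ∀ i : Fin d, μ.map (configSiteReflect i) = μ)
    (hsite : ∀ i : Fin d, IsReflectionPositiveFor (configSiteReflect (G := Matrix.specialUnitaryGroup (Fin N) ℂ) i)
      (siteHalfEdges i) μ)
    (hlink : ∀ i : Fin d, IsReflectionPositiveFor (configLinkReflect (G := Matrix.specialUnitaryGroup (Fin N) ℂ) i)
      (linkHalfEdges i) μ)
    (hdiag : ∀ i j : Fin d, i ≠ j →
      IsReflectionPositiveFor (configDiagSwapZd (G := Matrix.specialUnitaryGroup (Fin N) ℂ) i j) (diagHalfEdges i j) μ)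
    (P : C(LGConfig d (Matrix.specialUnitaryGroup (Fin N) ℂ), ℝ)) :
    ∫ U, P U ∂μ ∈ kzLevelValuesZdSuN (d := d) N β n P := by
  haveI := hμ.1
  haveI : SecondCountableTopology (Matrix (Fin N) (Fin N) ℂ) :=
    inferInstanceAs (SecondCountableTopology (Fin N → Fin N → ℂ))
  haveI : SecondCountableTopology (Matrix.specialUnitaryGroup (Fin N) ℂ) :=
    Topology.IsEmbedding.subtypeVal.secondCountableTopology
  obtain ⟨h1, h2, h3⟩ := expectationFunctional_fullSym_clauses (d := d) N hT hperm hrefl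
    (wordTruncation (ι := ZdEdge d) (fundamentalLatticeRep N) (n + n))
  exact ⟨expectationFunctional μ, isBootstrapFeasible_dlr_suN N β hμ (wordTruncation_subset_polyAlgebra _ n),
    h1, h2, h3, isSiteRPCutFunctional_expectation (fundamentalLatticeRep N) hsite n,
    isLinkRPCutFunctional_expectation (fundamentalLatticeRep N) hlink n,
    isDiagRPCutFunctional_expectation (fundamentalLatticeRep N) hdiag n, rfl⟩

/-- ★★★ **Every Class-B state is feasible for Kazakov–Zheng's complete infinite-lattice SDP at every
level.** For `ω : ClassBState d (fundamentalRep (Fin N)) β` (probability measure on `ℤ^d`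
configurations, `ℤ^d ⋊ B_d`-invariant, one-link Gibbs, reflection positive for the three mirror
families) and every level `n` and observable `P`: `∫ P dω.μ ∈ kzLevelValuesZdSuN N β n P`. [folklore] -/
theorem ClassBState.integral_mem_kzLevelValuesZd (ω : ClassBState d (fundamentalRep (Fin N)) β) (n : ℕ)
    (P : C(LGConfig d (Matrix.specialUnitaryGroup (Fin N) ℂ), ℝ)) :
    ∫ U, P U ∂ω.μ ∈ kzLevelValuesZdSuN (d := d) N β n P := by
  haveI := ω.isProbabilityMeasure
  haveI : SecondCountableTopology (Matrix (Fin N) (Fin N) ℂ) :=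
    inferInstanceAs (SecondCountableTopology (Fin N → Fin N → ℂ))
  haveI : SecondCountableTopology (Matrix.specialUnitaryGroup (Fin N) ℂ) :=
    Topology.IsEmbedding.subtypeVal.secondCountableTopology
  refine dlr_integral_mem_kzLevelValuesZd N β n
    (ω.mem_ymGibbsMeasures (fundamentalRep (Fin N)) (continuous_fundamentalRep _)) ω.translationInvariant
    (fun σ => ?_) (fun i => (ω.reflectInvariant i).map_eq) ω.siteRP ω.linkRP ω.diagRP P
  have h := (ω.permInvariant σ).map_eq
  have he : (configPerm σ : LGConfig d (Matrix.specialUnitaryGroup (Fin N) ℂ) → _) = relabelConfig (edgePerm σ) :=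
    funext (configPerm_eq_relabelConfig_edgePerm N σ)
  rwa [he] at h

/-- ★★ **A bound certified by the complete KZ SDP bounds every Class-B state** (SCOPING A18's
reading of a Kazakov–Zheng certificate, as a theorem about the tree's objects). -/
theorem ClassBState.integral_le_of_forall_kzLevelValuesZd_le (ω : ClassBState d (fundamentalRep (Fin N)) β)
    {n : ℕ} {P : C(LGConfig d (Matrix.specialUnitaryGroup (Fin N) ℂ), ℝ)} {c : ℝ}
    (hc : ∀ t ∈ kzLevelValuesZdSuN (d := d) N β n P, t ≤ c) : ∫ U, P U ∂ω.μ ≤ c :=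
  hc _ (ω.integral_mem_kzLevelValuesZd N β n P)

/-- Dually for lower bounds. -/
theorem ClassBState.le_integral_of_forall_le_kzLevelValuesZd (ω : ClassBState d (fundamentalRep (Fin N)) β)
    {n : ℕ} {P : C(LGConfig d (Matrix.specialUnitaryGroup (Fin N) ℂ), ℝ)} {c : ℝ}
    (hc : ∀ t ∈ kzLevelValuesZdSuN (d := d) N β n P, c ≤ t) : c ≤ ∫ U, P U ∂ω.μ :=
  hc _ (ω.integral_mem_kzLevelValuesZd N β n P)

/-- ★★ **A certificate with RP multipliers (site and link) bounds every Class-B state.** -/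
theorem ClassBState.integral_le_of_mem_rpFullCertCone (ω : ClassBState d (fundamentalRep (Fin N)) β)
    {n : ℕ} {P : C(LGConfig d (Matrix.specialUnitaryGroup (Fin N) ℂ), ℝ)} {c : ℝ}
    (hc : c • (1 : C(LGConfig d (Matrix.specialUnitaryGroup (Fin N) ℂ), ℝ)) - P ∈ rpFullCertConeZdSuN (d := d) N β n) :
    ∫ U, P U ∂ω.μ ≤ c :=
  le_of_mem_rpFullCertCone_suN N β hc _
    (kzLevelValuesZd_subset_rpFullSym N β n P (ω.integral_mem_kzLevelValuesZd N β n P))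

/-- ★★ **CONDITIONAL (`β ≥ 0`): under diagonal RP of the torus limit points** (the OPEN
`TorusLimitPointsDiagonalRP`, equivalent to the Class-B identification) **every thermodynamic limit
point of the torus Wilson states is feasible for the complete KZ SDP at every level.**
Unconditionally it is feasible for the SDP without the diagonal cuts
(`integral_mem_rpFullSymLevelValuesZd_of_mem_infiniteVolumeLimitPoints`). -/
theorem integral_mem_kzLevelValuesZd_of_torusLimitPointsDiagonalRP [NeZero d] {β : ℝ} (hβ : 0 ≤ β)
    (hdiag : TorusLimitPointsDiagonalRP d (fundamentalRep (Fin N)) β)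
    {μ : Measure (LGConfig d (Matrix.specialUnitaryGroup (Fin N) ℂ))}
    (hμ : μ ∈ infiniteVolumeLimitPoints (d := d) (fundamentalRep (Fin N)) β) (n : ℕ)
    (P : C(LGConfig d (Matrix.specialUnitaryGroup (Fin N) ℂ), ℝ)) :
    ∫ U, P U ∂μ ∈ kzLevelValuesZdSuN (d := d) N β n P := by
  haveI : SecondCountableTopology (Matrix (Fin N) (Fin N) ℂ) :=
    inferInstanceAs (SecondCountableTopology (Fin N → Fin N → ℂ))
  haveI : SecondCountableTopology (Matrix.specialUnitaryGroup (Fin N) ℂ) :=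
    Topology.IsEmbedding.subtypeVal.secondCountableTopology
  obtain ⟨ω, hω⟩ := thermodynamicLimitIsClassB_of_diagRP (fundamentalRep (Fin N)) (continuous_fundamentalRep _)
    hβ hdiag μ hμ
  rw [← hω]
  exact ω.integral_mem_kzLevelValuesZd N β n P

end ZdSuN

end Summit.QuantumFields.GaugeBoot

end
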